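import Summits.AtomisticToContinuum.HydrodynamicLimit.Theorems.EnskogAdjointDualityAdjointEnskogTestFamilyRSphereCalculusPrep
import Summits.AtomisticToContinuum.HydrodynamicLimit.Theorems.EnskogAdjointDualityAdjointEnskogTestFamilyRSphereCalculusRadial
import HarnessLib

/-!
# Sphere calculus on `S² ⊆ ℝ³` for the K2R refutation line (stub `stub_sphereCalculus`)

Route `EnskogAdjointDuality` of `AtomisticToContinuum/HydrodynamicLimit`, crux K2R
(`AdjointEnskogTestFamilyR`, stmt-AtomisticToContinuum-11592), line `refutation` (file 3 of 3).

The lead refutes K2R by testing the defect inequality against the critical velocity weights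
`Θ₀^R(v) = (1+|v|²)⁻³e^{-|v|²/R}` and `Θ₁^R(v) = |v|(1+|v|²)⁻⁴e^{-|v|²/R} v₀`; this file supplies the
sphere-integral calculus `stub_sphereCalculus`: (1) the degree-one Funk–Hecke formula
`∫ g(⟪a,ν⟫) ν dσ = (2π ∫_{-1}^{1} t g) a` (file `…SphereCalculusPrep`); (2) the trigonometric
delocalisation constants `8k/3 ≤ ∫ ν₀ sin(kν₀) dσ ≤ 4πk/3`, `k²/2 ≤ ∫ (1 - cos(kν₀)) dσ ≤ 2πk²/3`,
`0 ≤ ∫ ν₀²(1 - cos(kν₀)) dσ ≤ 2πk²/3` and the odd/transverse vanishings (ibid.); (3) the radial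
moments `J_R ≥ log R/25`, `|J_R - J'_R| ≤ 4` (file `…SphereCalculusRadial`) and, here, the
`ℝ³`-moments of `Θ₀^R`, `Θ₁^R` by polar coordinates (`∫ f = (∫_{S²} Y dσ) ∫₀^∞ r²φ`), the
substitution `E = r²` and Archimedes' hat-box constants `∫ (ν₀)₊³ dσ = π/2`, `∫ (ν₀)₊⁴ dσ = 2π/5`,
`∫ ν₀² dσ = 4π/3`: values `2πJ_R`, `2πJ'_R`, `(π/4)J_R`, `(π/5)J'_R`, `(2π/3)J'_R`, and the uniform
bound `2π² ≤ 20` for the low moments. [folklore]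
-/

noncomputable section

open MeasureTheory Real Set Filter Metric
open scoped InnerProductSpace ENNReal

namespace Summit.AtomisticToContinuum.HydrodynamicLimit.Theorems.EnskogAdjointDuality

open Literature.Analysis.FluidPDE Literature.MathematicalPhysics.KineticTheory
open Summit.AtomisticToContinuum.HydrodynamicLimit.Theorems.ClampedCorrectorBirth

/-! ### Radial bound for the low moments -/

/-- Radial functions whose profile is squeezed as `0 ≤ r² F(r) ≤ (1 + r²)⁻¹` are integrable on `ℝ³`
with `∫ F(|v|) dv ≤ 4π · π/2 = 2π² ≤ 20`. [folklore] -/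
theorem k2r_ref_radial_le_twenty (F : ℝ → ℝ) (hF : ContinuousOn F (Ioi 0))
    (h : ∀ r, 0 < r → 0 ≤ r ^ 2 * F r ∧ r ^ 2 * F r ≤ (1 + r ^ 2)⁻¹) :
    Integrable (fun v : EuclideanSpace ℝ (Fin 3) => F ‖v‖) ∧ ∫ v : EuclideanSpace ℝ (Fin 3), F ‖v‖ ≤ 20 := by
  have hint : IntegrableOn (fun r => r ^ 2 * F r) (Ioi 0) :=
    k2r_ref_integrableOn_Ioi_of_le ((continuousOn_pow 2).mul hF)
      integrable_inv_one_add_sq.integrableOn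
      fun r hr => by rw [abs_of_nonneg (h r hr).1]; exact (h r hr).2
  refine ⟨(k2r_ref_integrable_radial_iff F).2 hint, ?_⟩
  rw [k2r_ref_integral_radial]
  have hle : ∫ r in Ioi (0 : ℝ), r ^ 2 * F r ≤ π / 2 := by
    have := integral_mono_of_nonneg (μ := volume.restrict (Ioi (0 : ℝ)))
      (ae_restrict_of_forall_mem measurableSet_Ioi fun r hr => (h r hr).1)
      integrable_inv_one_add_sq.integrableOn
      (ae_restrict_of_forall_mem measurableSet_Ioi fun r hr => (h r hr).2)
    rwa [integral_Ioi_inv_one_add_sq, Real.arctan_zero, sub_zero] at this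
  nlinarith [Real.pi_pos, Real.pi_lt_d2]

/-! ### Moments of the critical weights on `ℝ³` -/

/-- **Moments of the critical velocity weights** `Θ₀^R(v) = (1+|v|²)⁻³e^{-|v|²/R}`,
`Θ₁^R(v) = |v|(1+|v|²)⁻⁴e^{-|v|²/R}` (`R ≥ 1`): integrability and the bound `20` for the low
moments, the values `2πJ_R`, `2πJ'_R`, `(π/4)J_R`, `(π/5)J'_R`, `(2π/3)J'_R` of the critical ones
(polar coordinates, `E = r²`, Archimedes), and two integrability facts for the assembly. [folklore] -/
theorem k2r_ref_R3_facts {R : ℝ} (hR : 1 ≤ R) :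
    (∀ k : ℕ, k ≤ 2 → Integrable (fun v : EuclideanSpace ℝ (Fin 3) =>
        ‖v‖ ^ k * (((1 + ‖v‖ ^ 2) ^ 3)⁻¹ * Real.exp (-‖v‖ ^ 2 / R))) ∧
      ∫ v : EuclideanSpace ℝ (Fin 3), ‖v‖ ^ k * (((1 + ‖v‖ ^ 2) ^ 3)⁻¹ * Real.exp (-‖v‖ ^ 2 / R)) ≤ 20) ∧
    (∀ k : ℕ, k ≤ 3 → Integrable (fun v : EuclideanSpace ℝ (Fin 3) => ‖v‖ ^ k *
        (Real.sqrt (‖v‖ ^ 2) * ((1 + ‖v‖ ^ 2) ^ 4)⁻¹ * Real.exp (-‖v‖ ^ 2 / R))) ∧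
      ∫ v : EuclideanSpace ℝ (Fin 3), ‖v‖ ^ k * (Real.sqrt (‖v‖ ^ 2) * ((1 + ‖v‖ ^ 2) ^ 4)⁻¹ * Real.exp (-‖v‖ ^ 2 / R))
        ≤ 20) ∧
    (Integrable (fun v : EuclideanSpace ℝ (Fin 3) => ‖v‖ ^ 3 * (((1 + ‖v‖ ^ 2) ^ 3)⁻¹ * Real.exp (-‖v‖ ^ 2 / R))) ∧
      ∫ v : EuclideanSpace ℝ (Fin 3), ‖v‖ ^ 3 * (((1 + ‖v‖ ^ 2) ^ 3)⁻¹ * Real.exp (-‖v‖ ^ 2 / R)) =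
        2 * Real.pi * ∫ E in Ioi (0 : ℝ), E ^ 2 * (((1 + E) ^ 3)⁻¹ * Real.exp (-E / R))) ∧
    (Integrable (fun v : EuclideanSpace ℝ (Fin 3) => ‖v‖ ^ 4 *
        (Real.sqrt (‖v‖ ^ 2) * ((1 + ‖v‖ ^ 2) ^ 4)⁻¹ * Real.exp (-‖v‖ ^ 2 / R))) ∧
      ∫ v : EuclideanSpace ℝ (Fin 3), ‖v‖ ^ 4 * (Real.sqrt (‖v‖ ^ 2) * ((1 + ‖v‖ ^ 2) ^ 4)⁻¹ * Real.exp (-‖v‖ ^ 2 / R)) =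
        2 * Real.pi * ∫ E in Ioi (0 : ℝ), E ^ 3 * ((1 + E) ^ 4)⁻¹ * Real.exp (-E / R)) ∧
    (Integrable (fun v : EuclideanSpace ℝ (Fin 3) =>
        ((1 + ‖v‖ ^ 2) ^ 3)⁻¹ * Real.exp (-‖v‖ ^ 2 / R) * max (v 0) 0 ^ 3) ∧
      ∫ v : EuclideanSpace ℝ (Fin 3), ((1 + ‖v‖ ^ 2) ^ 3)⁻¹ * Real.exp (-‖v‖ ^ 2 / R) * max (v 0) 0 ^ 3 =
        Real.pi / 4 * ∫ E in Ioi (0 : ℝ), E ^ 2 * (((1 + E) ^ 3)⁻¹ * Real.exp (-E / R))) ∧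
    (Integrable (fun v : EuclideanSpace ℝ (Fin 3) =>
        Real.sqrt (‖v‖ ^ 2) * ((1 + ‖v‖ ^ 2) ^ 4)⁻¹ * Real.exp (-‖v‖ ^ 2 / R) * max (v 0) 0 ^ 4) ∧
      ∫ v : EuclideanSpace ℝ (Fin 3), Real.sqrt (‖v‖ ^ 2) * ((1 + ‖v‖ ^ 2) ^ 4)⁻¹ * Real.exp (-‖v‖ ^ 2 / R) *
          max (v 0) 0 ^ 4 =
        Real.pi / 5 * ∫ E in Ioi (0 : ℝ), E ^ 3 * ((1 + E) ^ 4)⁻¹ * Real.exp (-E / R)) ∧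
    (Integrable (fun v : EuclideanSpace ℝ (Fin 3) =>
        Real.sqrt (‖v‖ ^ 2) * ((1 + ‖v‖ ^ 2) ^ 4)⁻¹ * Real.exp (-‖v‖ ^ 2 / R) * v 0 ^ 2 * ‖v‖ ^ 2) ∧
      ∫ v : EuclideanSpace ℝ (Fin 3), Real.sqrt (‖v‖ ^ 2) * ((1 + ‖v‖ ^ 2) ^ 4)⁻¹ * Real.exp (-‖v‖ ^ 2 / R) * v 0 ^ 2 *
          ‖v‖ ^ 2 =
        2 * Real.pi / 3 * ∫ E in Ioi (0 : ℝ), E ^ 3 * ((1 + E) ^ 4)⁻¹ * Real.exp (-E / R)) ∧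
    (Integrable (fun v : EuclideanSpace ℝ (Fin 3) =>
        Real.sqrt (‖v‖ ^ 2) * ((1 + ‖v‖ ^ 2) ^ 4)⁻¹ * Real.exp (-‖v‖ ^ 2 / R) * |v 0| *
          (1 + ‖v‖ ^ 2) ^ 4) ∧
      Integrable (fun v : EuclideanSpace ℝ (Fin 3) =>
        ((1 + ‖v‖ ^ 2) ^ 3)⁻¹ * Real.exp (-‖v‖ ^ 2 / R) * (1 + ‖v‖ ^ 2) ^ 4)) := by
  have hR0 : 0 < R := by linarith
  have he1 : ∀ r : ℝ, Real.exp (-r ^ 2 / R) ≤ 1 := fun r =>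
    Real.exp_le_one_iff.2 (by rw [neg_div]; exact neg_nonpos.2 (by positivity))
  -- the two radial profiles after the Jacobian `r²`
  set F0 : ℝ → ℝ := fun r => r ^ 3 * (((1 + r ^ 2) ^ 3)⁻¹ * Real.exp (-r ^ 2 / R)) with hF0
  set F1 : ℝ → ℝ := fun r => r ^ 4 * (Real.sqrt (r ^ 2) * ((1 + r ^ 2) ^ 4)⁻¹ * Real.exp (-r ^ 2 / R))
    with hF1
  have hF0i : IntegrableOn (fun r => r ^ 2 * F0 r) (Ioi 0) := by
    refine k2r_ref_integrableOn_Ioi_of_le (Continuous.continuousOn (by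
      simp only [hF0]; fun_prop (disch := intros; positivity)))
      (k2r_ref_integrableOn_pow_mul_exp hR0 1) fun r hr => ?_
    have h1 := k2r_ref_pow_le_one_add_sq_pow hr (n := 4) (m := 3) (by norm_num)
    simp only [hF0]
    rw [abs_of_nonneg (by positivity), pow_one]
    calc r ^ 2 * (r ^ 3 * (((1 + r ^ 2) ^ 3)⁻¹ * Real.exp (-r ^ 2 / R)))
        = r ^ 4 * ((1 + r ^ 2) ^ 3)⁻¹ * (r * Real.exp (-r ^ 2 / R)) := by ring
      _ ≤ (1 + r ^ 2) ^ 3 * ((1 + r ^ 2) ^ 3)⁻¹ * (r * Real.exp (-r ^ 2 / R)) := by gcongr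
      _ = r * Real.exp (-r ^ 2 / R) := by rw [mul_inv_cancel₀ (by positivity), one_mul]
  have hF1i : IntegrableOn (fun r => r ^ 2 * F1 r) (Ioi 0) := by
    refine k2r_ref_integrableOn_Ioi_of_le (Continuous.continuousOn (by
      simp only [hF1]; fun_prop (disch := intros; positivity)))
      (k2r_ref_integrableOn_pow_mul_exp hR0 1) fun r hr => ?_
    have h1 := k2r_ref_pow_le_one_add_sq_pow hr (n := 6) (m := 4) (by norm_num)
    simp only [hF1]
    rw [abs_of_nonneg (by positivity), pow_one, Real.sqrt_sq hr.le]
    calc r ^ 2 * (r ^ 4 * (r * ((1 + r ^ 2) ^ 4)⁻¹ * Real.exp (-r ^ 2 / R)))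
        = r ^ 6 * ((1 + r ^ 2) ^ 4)⁻¹ * (r * Real.exp (-r ^ 2 / R)) := by ring
      _ ≤ (1 + r ^ 2) ^ 4 * ((1 + r ^ 2) ^ 4)⁻¹ * (r * Real.exp (-r ^ 2 / R)) := by gcongr
      _ = r * Real.exp (-r ^ 2 / R) := by rw [mul_inv_cancel₀ (by positivity), one_mul]
  -- their values: `E = r²`
  have hF0v : ∫ r in Ioi (0 : ℝ), r ^ 2 * F0 r =
      1 / 2 * ∫ E in Ioi (0 : ℝ), E ^ 2 * (((1 + E) ^ 3)⁻¹ * Real.exp (-E / R)) := by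
    rw [← k2r_ref_integral_comp_sq (fun E => E ^ 2 * (((1 + E) ^ 3)⁻¹ * Real.exp (-E / R))),
      ← integral_const_mul]
    refine setIntegral_congr_fun measurableSet_Ioi fun r _ => ?_
    simp only [hF0]
    ring
  have hF1v : ∫ r in Ioi (0 : ℝ), r ^ 2 * F1 r =
      1 / 2 * ∫ E in Ioi (0 : ℝ), E ^ 3 * ((1 + E) ^ 4)⁻¹ * Real.exp (-E / R) := by
    rw [← k2r_ref_integral_comp_sq (fun E => E ^ 3 * ((1 + E) ^ 4)⁻¹ * Real.exp (-E / R)),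
      ← integral_const_mul]
    refine setIntegral_congr_fun measurableSet_Ioi fun r hr => ?_
    simp only [hF1]
    rw [Real.sqrt_sq (le_of_lt hr)]
    ring
  -- polar geometry
  have hns : ∀ (r : ℝ), 0 < r → ∀ ω : sphere (0 : EuclideanSpace ℝ (Fin 3)) 1, ‖r • (ω : EuclideanSpace ℝ (Fin 3))‖ = r := fun r hr ω => by
    rw [norm_smul, norm_eq_of_mem_sphere ω, mul_one, Real.norm_of_nonneg hr.le]
  have hsm : ∀ (r : ℝ) (ω : sphere (0 : EuclideanSpace ℝ (Fin 3)) 1), (r • (ω : EuclideanSpace ℝ (Fin 3))) 0 = r * (ω : EuclideanSpace ℝ (Fin 3)) 0 := fun r ω => by simp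
  have hmax : ∀ v : EuclideanSpace ℝ (Fin 3), |max (v 0) 0| ≤ ‖v‖ := fun v => by
    rw [abs_of_nonneg (le_max_right _ _)]
    exact max_le ((le_abs_self _).trans (by simpa using PiLp.norm_apply_le v 0)) (norm_nonneg _)
  have hv0 : ∀ v : EuclideanSpace ℝ (Fin 3), |v 0| ≤ ‖v‖ := fun v => by simpa using PiLp.norm_apply_le v 0
  refine ⟨fun k hk => ?_, fun k hk => ?_, ⟨?_, ?_⟩, ⟨?_, ?_⟩, ?_, ?_, ?_, ?_, ?_⟩
  · -- low moments of `Θ₀`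
    refine k2r_ref_radial_le_twenty (fun r => r ^ k * (((1 + r ^ 2) ^ 3)⁻¹ * Real.exp (-r ^ 2 / R)))
      (Continuous.continuousOn (by fun_prop (disch := intros; positivity))) fun r hr => ?_
    have := k2r_ref_pow_div_le hr (n := k + 2) (m := 3) (by omega) (Real.exp_pos (-r ^ 2 / R)).le
      (he1 r)
    rwa [show r ^ (k + 2) * ((1 + r ^ 2) ^ 3)⁻¹ * Real.exp (-r ^ 2 / R) =
      r ^ 2 * (r ^ k * (((1 + r ^ 2) ^ 3)⁻¹ * Real.exp (-r ^ 2 / R))) by ring] at this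
  · -- low moments of `Θ₁`
    refine k2r_ref_radial_le_twenty
      (fun r => r ^ k * (Real.sqrt (r ^ 2) * ((1 + r ^ 2) ^ 4)⁻¹ * Real.exp (-r ^ 2 / R)))
      (Continuous.continuousOn (by fun_prop (disch := intros; positivity))) fun r hr => ?_
    have := k2r_ref_pow_div_le hr (n := k + 3) (m := 4) (by omega) (Real.exp_pos (-r ^ 2 / R)).le
      (he1 r)
    rw [Real.sqrt_sq hr.le]
    rwa [show r ^ (k + 3) * ((1 + r ^ 2) ^ 4)⁻¹ * Real.exp (-r ^ 2 / R) =
      r ^ 2 * (r ^ k * (r * ((1 + r ^ 2) ^ 4)⁻¹ * Real.exp (-r ^ 2 / R))) by ring] at this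
  · exact (k2r_ref_integrable_radial_iff F0).2 hF0i
  · rw [k2r_ref_integral_radial F0, hF0v]; ring
  · exact (k2r_ref_integrable_radial_iff F1).2 hF1i
  · rw [k2r_ref_integral_radial F1, hF1v]; ring
  · -- `Θ₀ (v₀)₊³`
    have hint : Integrable (fun v : EuclideanSpace ℝ (Fin 3) =>
        ((1 + ‖v‖ ^ 2) ^ 3)⁻¹ * Real.exp (-‖v‖ ^ 2 / R) * max (v 0) 0 ^ 3) := by
      refine k2r_ref_integrable_of_norm_le (by fun_prop (disch := intros; positivity)) F0 hF0i
        fun v => ?_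
      rw [abs_mul, abs_of_nonneg (by positivity), abs_pow, hF0]
      calc ((1 + ‖v‖ ^ 2) ^ 3)⁻¹ * Real.exp (-‖v‖ ^ 2 / R) * |max (v 0) 0| ^ 3
          ≤ ((1 + ‖v‖ ^ 2) ^ 3)⁻¹ * Real.exp (-‖v‖ ^ 2 / R) * ‖v‖ ^ 3 := by gcongr; exact hmax v
        _ = _ := by ring
    refine ⟨hint, ?_⟩
    rw [k2r_ref_integral_polar hint F0 (fun ω => max ((ω : EuclideanSpace ℝ (Fin 3)) 0) 0 ^ 3) fun r hr ω => by
      rw [hns r hr, hsm, k2r_ref_max_mul hr.le, hF0]; ring,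
      k2r_ref_integral_coord_pos_pow 0 (by norm_num), hF0v]
    norm_num
    ring
  · -- `Θ₁ (v₀)₊⁴`
    have hint : Integrable (fun v : EuclideanSpace ℝ (Fin 3) =>
        Real.sqrt (‖v‖ ^ 2) * ((1 + ‖v‖ ^ 2) ^ 4)⁻¹ * Real.exp (-‖v‖ ^ 2 / R) * max (v 0) 0 ^ 4) := by
      refine k2r_ref_integrable_of_norm_le (by fun_prop (disch := intros; positivity)) F1 hF1i
        fun v => ?_
      rw [abs_mul, abs_of_nonneg (by positivity), abs_pow, hF1]
      calc Real.sqrt (‖v‖ ^ 2) * ((1 + ‖v‖ ^ 2) ^ 4)⁻¹ * Real.exp (-‖v‖ ^ 2 / R) * |max (v 0) 0| ^ 4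
          ≤ Real.sqrt (‖v‖ ^ 2) * ((1 + ‖v‖ ^ 2) ^ 4)⁻¹ * Real.exp (-‖v‖ ^ 2 / R) * ‖v‖ ^ 4 := by
            gcongr; exact hmax v
        _ = _ := by ring
    refine ⟨hint, ?_⟩
    rw [k2r_ref_integral_polar hint F1 (fun ω => max ((ω : EuclideanSpace ℝ (Fin 3)) 0) 0 ^ 4) fun r hr ω => by
      rw [hns r hr, hsm, k2r_ref_max_mul hr.le, hF1]; ring,
      k2r_ref_integral_coord_pos_pow 0 (by norm_num), hF1v]
    norm_num
    ring
  · -- `Θ₁ v₀² |v|²`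
    have hint : Integrable (fun v : EuclideanSpace ℝ (Fin 3) =>
        Real.sqrt (‖v‖ ^ 2) * ((1 + ‖v‖ ^ 2) ^ 4)⁻¹ * Real.exp (-‖v‖ ^ 2 / R) * v 0 ^ 2 * ‖v‖ ^ 2) := by
      refine k2r_ref_integrable_of_norm_le (by fun_prop (disch := intros; positivity)) F1 hF1i
        fun v => ?_
      have h2 : v 0 ^ 2 ≤ ‖v‖ ^ 2 := by
        rw [← sq_abs]; exact pow_le_pow_left₀ (abs_nonneg _) (hv0 v) 2
      rw [abs_of_nonneg (by positivity), hF1]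
      calc Real.sqrt (‖v‖ ^ 2) * ((1 + ‖v‖ ^ 2) ^ 4)⁻¹ * Real.exp (-‖v‖ ^ 2 / R) * v 0 ^ 2 * ‖v‖ ^ 2
          ≤ Real.sqrt (‖v‖ ^ 2) * ((1 + ‖v‖ ^ 2) ^ 4)⁻¹ * Real.exp (-‖v‖ ^ 2 / R) * ‖v‖ ^ 2 * ‖v‖ ^ 2 :=
            by gcongr
        _ = _ := by ring
    refine ⟨hint, ?_⟩
    rw [k2r_ref_integral_polar hint F1 (fun ω => (ω : EuclideanSpace ℝ (Fin 3)) 0 ^ 2) fun r hr ω => by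
      rw [hns r hr, hsm, hF1]; ring, k2r_ref_integral_coord_sq 0, hF1v]
    ring
  · -- `Θ₁ |v₀| (1+|v|²)⁴ ≤ |v|² e^{-|v|²/R}`
    refine k2r_ref_integrable_of_norm_le (by fun_prop (disch := intros; positivity))
      (fun r => r ^ 2 * Real.exp (-r ^ 2 / R))
      ((k2r_ref_integrableOn_pow_mul_exp hR0 4).congr_fun (fun r _ => by ring) measurableSet_Ioi)
      fun v => ?_
    have hq : (1 + ‖v‖ ^ 2) ^ 4 ≠ 0 := by positivity
    rw [Real.sqrt_sq (norm_nonneg v), abs_of_nonneg (by positivity)]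
    calc ‖v‖ * ((1 + ‖v‖ ^ 2) ^ 4)⁻¹ * Real.exp (-‖v‖ ^ 2 / R) * |v 0| * (1 + ‖v‖ ^ 2) ^ 4
        = ‖v‖ * |v 0| * Real.exp (-‖v‖ ^ 2 / R) := by field_simp
      _ ≤ ‖v‖ * ‖v‖ * Real.exp (-‖v‖ ^ 2 / R) := by gcongr; exact hv0 v
      _ = _ := by ring
  · -- `Θ₀ (1+|v|²)⁴ = (1+|v|²) e^{-|v|²/R}` is radial
    refine (k2r_ref_integrable_radial_iff
      (fun r => ((1 + r ^ 2) ^ 3)⁻¹ * Real.exp (-r ^ 2 / R) * (1 + r ^ 2) ^ 4)).2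
      (((k2r_ref_integrableOn_pow_mul_exp hR0 2).add (k2r_ref_integrableOn_pow_mul_exp hR0 4)).congr_fun
        (fun r _ => ?_) measurableSet_Ioi)
    have hq : (1 + r ^ 2) ^ 3 ≠ 0 := by positivity
    rw [Pi.add_apply]
    field_simp

/-! ### The registered stub -/

/-- **Stub `stub_sphereCalculus` of the K2R refutation line** (verbatim the Prop `SphereCalculus` of
`Cruxes/AdjointEnskogTestFamilyR/Lines/refutation.lean`): the degree-one Funk–Hecke formula, the
trigonometric delocalisation constants with their odd/transverse vanishings, and the radial moments
`J_R`, `J'_R` of the critical velocity weights with the `ℝ³`-moments used by the assembly. [folklore] -/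
theorem stub_sphereCalculus :
  (∀ (a : EuclideanSpace ℝ (Fin 3)), ‖a‖ = 1 → ∀ g : ℝ → ℝ, ContinuousOn g (Set.Icc (-1) 1) →
    (∫ ν : Metric.sphere (0 : EuclideanSpace ℝ (Fin 3)) 1,
        g (inner ℝ a (ν : EuclideanSpace ℝ (Fin 3))) • (ν : EuclideanSpace ℝ (Fin 3)) ∂sphereMeasure)
      = (2 * Real.pi * ∫ t in (-1 : ℝ)..1, t * g t) • a) ∧
  (∀ k : ℝ, 0 ≤ k → k ≤ Real.pi / 2 →
    (∫ ν : Metric.sphere (0 : EuclideanSpace ℝ (Fin 3)) 1,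
        Real.sin (k * (ν : EuclideanSpace ℝ (Fin 3)) 0) ∂sphereMeasure) = 0 ∧
    (∫ ν : Metric.sphere (0 : EuclideanSpace ℝ (Fin 3)) 1,
        (ν : EuclideanSpace ℝ (Fin 3)) 0 * (Real.cos (k * (ν : EuclideanSpace ℝ (Fin 3)) 0) - 1) ∂sphereMeasure) = 0 ∧
    (∀ j : Fin 3, j ≠ 0 → ∀ g : ℝ → ℝ, ContinuousOn g (Set.Icc (-1) 1) →
      (∫ ν : Metric.sphere (0 : EuclideanSpace ℝ (Fin 3)) 1,
          (ν : EuclideanSpace ℝ (Fin 3)) j * g ((ν : EuclideanSpace ℝ (Fin 3)) 0) ∂sphereMeasure) = 0 ∧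
      (∫ ν : Metric.sphere (0 : EuclideanSpace ℝ (Fin 3)) 1,
          (ν : EuclideanSpace ℝ (Fin 3)) 0 * (ν : EuclideanSpace ℝ (Fin 3)) j *
            g ((ν : EuclideanSpace ℝ (Fin 3)) 0) ∂sphereMeasure) = 0) ∧
    8 * k / 3 ≤ (∫ ν : Metric.sphere (0 : EuclideanSpace ℝ (Fin 3)) 1,
        (ν : EuclideanSpace ℝ (Fin 3)) 0 * Real.sin (k * (ν : EuclideanSpace ℝ (Fin 3)) 0) ∂sphereMeasure) ∧
    (∫ ν : Metric.sphere (0 : EuclideanSpace ℝ (Fin 3)) 1,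
        (ν : EuclideanSpace ℝ (Fin 3)) 0 * Real.sin (k * (ν : EuclideanSpace ℝ (Fin 3)) 0) ∂sphereMeasure)
      ≤ 4 * Real.pi * k / 3 ∧
    k ^ 2 / 2 ≤ (∫ ν : Metric.sphere (0 : EuclideanSpace ℝ (Fin 3)) 1,
        (1 - Real.cos (k * (ν : EuclideanSpace ℝ (Fin 3)) 0)) ∂sphereMeasure) ∧
    (∫ ν : Metric.sphere (0 : EuclideanSpace ℝ (Fin 3)) 1,
        (1 - Real.cos (k * (ν : EuclideanSpace ℝ (Fin 3)) 0)) ∂sphereMeasure) ≤ 2 * Real.pi * k ^ 2 / 3 ∧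
    0 ≤ (∫ ν : Metric.sphere (0 : EuclideanSpace ℝ (Fin 3)) 1,
        (ν : EuclideanSpace ℝ (Fin 3)) 0 ^ 2 * (1 - Real.cos (k * (ν : EuclideanSpace ℝ (Fin 3)) 0)) ∂sphereMeasure) ∧
    (∫ ν : Metric.sphere (0 : EuclideanSpace ℝ (Fin 3)) 1,
        (ν : EuclideanSpace ℝ (Fin 3)) 0 ^ 2 * (1 - Real.cos (k * (ν : EuclideanSpace ℝ (Fin 3)) 0)) ∂sphereMeasure)
      ≤ 2 * Real.pi * k ^ 2 / 3) ∧
  (let th0 : ℝ → ℝ → ℝ := fun R E => ((1 + E) ^ 3)⁻¹ * Real.exp (-E / R)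
   let th1 : ℝ → ℝ → ℝ := fun R E => Real.sqrt E * ((1 + E) ^ 4)⁻¹ * Real.exp (-E / R)
   let J : ℝ → ℝ := fun R => ∫ E in Set.Ioi (0 : ℝ), E ^ 2 * th0 R E
   let J' : ℝ → ℝ := fun R => ∫ E in Set.Ioi (0 : ℝ), E ^ 3 * ((1 + E) ^ 4)⁻¹ * Real.exp (-E / R)
   ∀ R : ℝ, 1 ≤ R →
    (IntegrableOn (fun E => E ^ 2 * th0 R E) (Set.Ioi 0) ∧
     IntegrableOn (fun E => E ^ 3 * ((1 + E) ^ 4)⁻¹ * Real.exp (-E / R)) (Set.Ioi 0) ∧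
     Real.log R / 25 ≤ J R ∧ |J R - J' R| ≤ 4 ∧ 0 ≤ J' R) ∧
    (∀ k : ℕ, k ≤ 2 → Integrable (fun v : EuclideanSpace ℝ (Fin 3) => ‖v‖ ^ k * th0 R (‖v‖ ^ 2)) ∧
      ∫ v : EuclideanSpace ℝ (Fin 3), ‖v‖ ^ k * th0 R (‖v‖ ^ 2) ≤ 20) ∧
    (∀ k : ℕ, k ≤ 3 → Integrable (fun v : EuclideanSpace ℝ (Fin 3) => ‖v‖ ^ k * th1 R (‖v‖ ^ 2)) ∧
      ∫ v : EuclideanSpace ℝ (Fin 3), ‖v‖ ^ k * th1 R (‖v‖ ^ 2) ≤ 20) ∧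
    (Integrable (fun v : EuclideanSpace ℝ (Fin 3) => ‖v‖ ^ 3 * th0 R (‖v‖ ^ 2)) ∧
      ∫ v : EuclideanSpace ℝ (Fin 3), ‖v‖ ^ 3 * th0 R (‖v‖ ^ 2) = 2 * Real.pi * J R) ∧
    (Integrable (fun v : EuclideanSpace ℝ (Fin 3) => ‖v‖ ^ 4 * th1 R (‖v‖ ^ 2)) ∧
      ∫ v : EuclideanSpace ℝ (Fin 3), ‖v‖ ^ 4 * th1 R (‖v‖ ^ 2) = 2 * Real.pi * J' R) ∧
    (Integrable (fun v : EuclideanSpace ℝ (Fin 3) => th0 R (‖v‖ ^ 2) * max (v 0) 0 ^ 3) ∧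
      ∫ v : EuclideanSpace ℝ (Fin 3), th0 R (‖v‖ ^ 2) * max (v 0) 0 ^ 3 = Real.pi / 4 * J R) ∧
    (Integrable (fun v : EuclideanSpace ℝ (Fin 3) => th1 R (‖v‖ ^ 2) * max (v 0) 0 ^ 4) ∧
      ∫ v : EuclideanSpace ℝ (Fin 3), th1 R (‖v‖ ^ 2) * max (v 0) 0 ^ 4 = Real.pi / 5 * J' R) ∧
    (Integrable (fun v : EuclideanSpace ℝ (Fin 3) => th1 R (‖v‖ ^ 2) * (v 0) ^ 2 * ‖v‖ ^ 2) ∧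
      ∫ v : EuclideanSpace ℝ (Fin 3), th1 R (‖v‖ ^ 2) * (v 0) ^ 2 * ‖v‖ ^ 2 = 2 * Real.pi / 3 * J' R) ∧
    (Integrable (fun v : EuclideanSpace ℝ (Fin 3) => th1 R (‖v‖ ^ 2) * |v 0| * (1 + ‖v‖ ^ 2) ^ 4) ∧
      Integrable (fun v : EuclideanSpace ℝ (Fin 3) => th0 R (‖v‖ ^ 2) * (1 + ‖v‖ ^ 2) ^ 4))) := by
  refine ⟨fun a ha g hg => k2r_ref_funkHecke_one a ha g hg, fun k hk0 hk1 => ?_, ?_⟩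
  · obtain ⟨h1, h2, h3, h4, h5, h6⟩ := k2r_ref_sphere_trig 0 hk0 hk1
    exact ⟨(k2r_ref_sphere_odd_vanish 0 k).1, (k2r_ref_sphere_odd_vanish 0 k).2,
      fun j hj g _ => k2r_ref_sphere_transverse_vanish hj g, h1, h2, h3, h4, h5, h6⟩
  · intro th0 th1 J J' R hR
    obtain ⟨a1, a2, a3, a4, a5⟩ := k2r_ref_J_facts hR
    obtain ⟨b1, b2, b3, b4, b5, b6, b7, b8⟩ := k2r_ref_R3_facts hR
    exact ⟨⟨a1, a2, a3, a4, a5⟩, b1, b2, b3, b4, b5, b6, b7, b8⟩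

end Summit.AtomisticToContinuum.HydrodynamicLimit.Theorems.EnskogAdjointDuality

end
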